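/-
Copyright (c) 2026. All rights reserved.
Released under Apache 2.0 license as described in the file LICENSE.
Authors: abc-iut cell, F fact-proving wave seat abc-iut-f-073 (tranche 73, exact criterion for F-0319).
-/
import Literature.AnabelianGeometry.AbsoluteAnabelian.LaxShadowFamilies
import Literature.AnabelianGeometry.AbsoluteAnabelian.AbsTopIII.BiAnabelianDeltaFamilyProofs
import Literature.AnabelianGeometry.AbsoluteAnabelian.AbsTopIII.BiAnabelianIncompatibilityKernelPaths

/-!
# [AbsTopIII] Cor 3.7 (iv), first incompatibility — the pseudo-commuting shadow of `𝒟†_{≤3}`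
# determined by a natural isomorphism `ζ : 𝟭 ≅ log`

S. Mochizuki, *Topics in absolute anabelian geometry III* [MochizukiAbsTopIII2015] (kurims manuscript
`paper:url-5493eb38cbb7`; journal pagination not held), Cor 3.7 (iii)/(iv) p. 88, Def 3.5 (ii) p. 75.

Construction companion of `BiAnabelianIncompatibility.lean` (abc-iut-L4-t9; schema row F-0319
`IncompatibleStmt`), step 1 of the second half of the EXACT CRITERION
`IncompatibleStmt 𝔖 ↔ ¬ LogCoreKernel 𝔖` (first half: `BiAnabelianIncompatibilityKernelNecessity.lean`;
steps 2–3: `…KernelCells.lean`, `…KernelFamily.lean`).  Given ANY `ζ : 𝟭_𝒳 ≅ log`: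

* `kerShadow ζ` — a PSEUDO-commuting shadow (abc-iut-L4-t12's `PseudoShadow`) of `𝒟†_{≤3}`
  (`logObsDiagram`): shadow category `𝒳` on rows 1–2 (t12's `deltaSh`) with augmentation `pr_⋎` on
  row 1 and the identity at `□`, shadow `𝒩` with the identity at the observation vertex; shadow of
  `log_𝒳` = `𝟭_𝒳` with edge 2-cell `log_𝒳 ⋙ pr = pr ⋙ log ≅ pr ⋙ 𝟭` given by `ζ⁻¹` — the one
  non-trivial 2-cell, absorbing the log-Frobenius functor into the coherence data; shadows of `pr_⋎`,
  `λ^×`, `λ^{×pf}` are `𝟭`, `λ^×`, `λ^{×pf}` with identity 2-cells (`kerCan`; computation rules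
  `kerShadow_canE_*`, all `rfl`).
* `kerFF` — the augmentation is fully faithful (indeed an identity functor) at every admissible vertex
  (`kerGood`: all but row 1, where no boundary pair will end).
* `kerShadow_shP_lvBox_eq` — any two paths into `□` with the same initial vertex have the SAME shadow
  (`𝟭_𝒳` along row 1, `kerShadow_shP_first`): the fact that makes "identity cells" between all
  would-be core pairs `([pr_{⋎+1}], [pr_⋎]∘[log_𝒳])` available.

Nothing here bears on [IUTchIII] Cor. 3.12; no claim of the paper is asserted; for the MLF data no
such `ζ` is compatible with `ι_log`, `ι_×` (Lemma 3.4) — the shadow exists for every `ζ` regardless.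
-/

set_option autoImplicit false

namespace Literature.AnabelianGeometry.AbsoluteAnabelian.AbsTopIII

open CategoryTheory Quiver DiagramOfCategories

universe u

namespace BiAnabelianSetting

variable {X E N : Type u} [Category.{u} X] [Category.{u} E] [Category.{u} N]
  (𝔖 : BiAnabelianSetting X E N)

/-! ## The pseudo-commuting shadow of `𝒟†_{≤3}` determined by `ζ : 𝟭 ≅ log` -/

section Shadow

variable (X E N) in
/-- Shadow categories of `𝒟†_{≤3}`: `𝒳` on rows 1–2 (t12's `deltaSh` on the `𝒟*`-vertices), `𝒩` at the
observation vertex. [cite: MochizukiAbsTopIII2015, Cor 3.7 (iii) p.88] -/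
def kerSh : logObsShape.{u}.Vertex → Cat.{u, u}
  | .base a => deltaSh X E N a.1
  | .obs => Cat.of N

/-- Augmentations: `pr_⋎` on row 1, identities elsewhere. [cite: MochizukiAbsTopIII2015, Cor 3.7 (iii) p.88] -/
def kerAug : ∀ a : logObsShape.{u}.Vertex, 𝔖.logObsDiagram.obj a ⥤ kerSh X E N a
  | .base ⟨.first _, _⟩ => 𝔖.pr
  | .base ⟨.box, _⟩ => 𝟭 X
  | .base ⟨.space, _⟩ => 𝟭 N
  | .base ⟨.galois, _⟩ => 𝟭 E
  | .base ⟨.ref, _⟩ => 𝟭 X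
  | .obs => 𝟭 N

/-- Shadows of the observation edges `λ^×`, `λ^{×pf} : □ → 𝒩` (themselves).
[cite: MochizukiAbsTopIII2015, Cor 3.7 (iii) p.88] -/
def kerSheObs : ∀ (a : SubVertex {a : Cor37Vertex | a.InDaggerLe 2}),
    logObsI.{u} a → (deltaSh X E N a.1 ⥤ Cat.of N)
  | ⟨.box, _⟩, ⟨true⟩ => 𝔖.lamTimes
  | ⟨.box, _⟩, ⟨false⟩ => 𝔖.lamTimesPf
  | ⟨.first _, _⟩, i => PEmpty.elim i
  | ⟨.space, _⟩, i => PEmpty.elim i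
  | ⟨.galois, _⟩, i => PEmpty.elim i
  | ⟨.ref, _⟩, i => PEmpty.elim i

/-- Shadows of the edges: `𝟭_𝒳` for `log_𝒳` and `pr_⋎` (t12's `deltaShe`), `λ^×`, `λ^{×pf}` for the
observation edges. [cite: MochizukiAbsTopIII2015, Cor 3.7 (iii) p.88] -/
def kerShe : ∀ {a b : logObsShape.{u}.Vertex}, (a ⟶ b) → (kerSh X E N a ⥤ kerSh X E N b)
  | .base _, .base _, e => 𝔖.deltaShe e
  | .base a, .obs, i => 𝔖.kerSheObs a i
  | .obs, .base _, j => PEmpty.elim j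
  | .obs, .obs, e => PEmpty.elim e

variable (ζ : 𝟭 X ≅ 𝔖.log)

/-- Edge 2-cells: over `log_𝒳` the isomorphism `log_𝒳 ⋙ pr = pr ⋙ log ≅ pr ⋙ 𝟭` given by `ζ⁻¹`;
identities over `pr_⋎`, `λ^×`, `λ^{×pf}` (the remaining edges of `Γ⃗_{𝒟*}` do not occur in `𝒟†_{≤3}`:
their endpoints violate the row / `𝒟†` conditions). [cite: MochizukiAbsTopIII2015, Cor 3.7 (iii) p.88] -/
def kerCan : ∀ {a b : logObsShape.{u}.Vertex} (e : a ⟶ b),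
    𝔖.logObsDiagram.map e ⋙ 𝔖.kerAug b ≅ 𝔖.kerAug a ⋙ 𝔖.kerShe e
  | .base ⟨.first _, _⟩, .base ⟨.first _, _⟩, Cor37Edge.log _ _ _ =>
    Functor.isoWhiskerLeft 𝔖.pr ζ.symm
  | .base ⟨.first _, _⟩, .base ⟨.box, _⟩, Cor37Edge.pr _ => Iso.refl _
  | .base ⟨.first _, _⟩, .base ⟨.ref, h⟩, Cor37Edge.proj _ => absurd rfl h.1
  | .base ⟨.box, _⟩, .base ⟨.space, _⟩, Cor37Edge.lamTimes => Iso.refl _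
  | .base ⟨.box, _⟩, .base ⟨.space, _⟩, Cor37Edge.lamTimesPf => Iso.refl _
  | .base ⟨.space, _⟩, .base ⟨.galois, _⟩, Cor37Edge.toGal => Iso.refl _
  | .base ⟨.ref, h⟩, .base ⟨.first _, _⟩, Cor37Edge.diag _ => absurd rfl h.1
  | .base ⟨.ref, h⟩, .base ⟨.box, _⟩, Cor37Edge.diagBox => absurd rfl h.1
  | .base ⟨.box, _⟩, .obs, ⟨true⟩ => Iso.refl _
  | .base ⟨.box, _⟩, .obs, ⟨false⟩ => Iso.refl _
  | .base ⟨.first _, _⟩, .obs, i => PEmpty.elim i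
  | .base ⟨.space, _⟩, .obs, i => PEmpty.elim i
  | .base ⟨.galois, _⟩, .obs, i => PEmpty.elim i
  | .base ⟨.ref, _⟩, .obs, i => PEmpty.elim i
  | .obs, .base _, j => PEmpty.elim j
  | .obs, .obs, e => PEmpty.elim e

/-- **The pseudo-commuting shadow of `𝒟†_{≤3}` determined by `ζ : 𝟭 ≅ log`.**
[cite: MochizukiAbsTopIII2015, Cor 3.7 (iii) p.88] -/
def kerShadow : 𝔖.logObsDiagram.PseudoShadow where
  Sh := kerSh X E N
  aug := 𝔖.kerAug
  she e := 𝔖.kerShe e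
  can e := 𝔖.kerCan ζ e

/-- The augmentation is fully faithful at every admissible vertex (it is an identity functor there).
[cite: MochizukiAbsTopIII2015, Cor 3.7 (iv) p.88] -/
noncomputable def kerFF : ∀ b : logObsShape.{u}.Vertex, kerGood b → ((𝔖.kerShadow ζ).aug b).FullyFaithful
  | .base ⟨.first _, _⟩, h => h.elim
  | .base ⟨.box, _⟩, _ => Functor.FullyFaithful.id X
  | .base ⟨.space, _⟩, _ => Functor.FullyFaithful.id N
  | .base ⟨.galois, _⟩, _ => Functor.FullyFaithful.id E
  | .base ⟨.ref, _⟩, _ => Functor.FullyFaithful.id X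
  | .obs, _ => Functor.FullyFaithful.id N

/-! ### Computation rules of the shadow (all `rfl`) -/

/-- The shadow of `log_𝒳` is `𝟭_𝒳`. [cite: MochizukiAbsTopIII2015, Cor 3.7 (iii) p.88] -/
theorem kerShadow_she_eLog (n : ℤ) : (𝔖.kerShadow ζ).she (eLog n) = 𝟭 X := rfl

/-- The shadow of `pr_⋎` is `𝟭_𝒳`. [cite: MochizukiAbsTopIII2015, Cor 3.7 (iii) p.88] -/
theorem kerShadow_she_ePr (n : ℤ) : (𝔖.kerShadow ζ).she (ePr n) = 𝟭 X := rfl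

/-- The shadow of `λ^×` is `λ^×`. [cite: MochizukiAbsTopIII2015, Cor 3.7 (iii) p.88] -/
theorem kerShadow_she_eLamTimes : (𝔖.kerShadow ζ).she eLamTimes.{u} = 𝔖.lamTimes := rfl

/-- The shadow of `λ^{×pf}` is `λ^{×pf}`. [cite: MochizukiAbsTopIII2015, Cor 3.7 (iii) p.88] -/
theorem kerShadow_she_eLamPf : (𝔖.kerShadow ζ).she eLamPf.{u} = 𝔖.lamTimesPf := rfl

/-- The edge 2-cell over `log_𝒳` at an object is `ζ⁻¹` at its first component.
[cite: MochizukiAbsTopIII2015, Cor 3.7 (iii) p.88] -/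
theorem kerShadow_canE_eLog (n : ℤ) (o : 𝔖.Sq) :
    (𝔖.kerShadow ζ).canE (eLog n) o = ζ.inv.app o.fst := rfl

/-- The inverse edge 2-cell over `log_𝒳` at an object is `ζ` at its first component.
[cite: MochizukiAbsTopIII2015, Cor 3.7 (iii) p.88] -/
theorem kerShadow_canEI_eLog (n : ℤ) (o : 𝔖.Sq) :
    (𝔖.kerShadow ζ).canEI (eLog n) o = ζ.hom.app o.fst := rfl

/-- The edge 2-cell over `pr_⋎` is the identity. [cite: MochizukiAbsTopIII2015, Cor 3.7 (iii) p.88] -/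
theorem kerShadow_canE_ePr (n : ℤ) (o : 𝔖.Sq) : (𝔖.kerShadow ζ).canE (ePr n) o = 𝟙 o.fst := rfl

/-- The inverse edge 2-cell over `pr_⋎` is the identity. [cite: MochizukiAbsTopIII2015, Cor 3.7 (iii) p.88] -/
theorem kerShadow_canEI_ePr (n : ℤ) (o : 𝔖.Sq) : (𝔖.kerShadow ζ).canEI (ePr n) o = 𝟙 o.fst := rfl

/-- The edge 2-cell over `λ^×` is the identity. [cite: MochizukiAbsTopIII2015, Cor 3.7 (iii) p.88] -/
theorem kerShadow_canE_eLamTimes (x : X) :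
    (𝔖.kerShadow ζ).canE eLamTimes.{u} x = 𝟙 (𝔖.lamTimes.obj x) := rfl

/-- The inverse edge 2-cell over `λ^{×pf}` is the identity. [cite: MochizukiAbsTopIII2015, Cor 3.7 (iii) p.88] -/
theorem kerShadow_canEI_eLamPf (x : X) :
    (𝔖.kerShadow ζ).canEI eLamPf.{u} x = 𝟙 (𝔖.lamTimesPf.obj x) := rfl

end Shadow

/-! ## Shadows of paths: every path into `□` (or along row 1) has identity shadow -/

section ShadowPaths

variable (ζ : 𝟭 X ≅ 𝔖.log)

/-- Paths along row 1 have shadow `𝟭_𝒳`. [cite: MochizukiAbsTopIII2015, Cor 3.7 (iii) p.88] -/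
theorem kerShadow_shP_first (m : ℤ) : ∀ {b : logObsShape.{u}.Vertex} (q : Path (lvFirst.{u} m) b) (n : ℤ)
    (h : (Cor37Vertex.first n).InDaggerLe 2), b = logObsShape.{u}.base ⟨.first n, h⟩ →
    HEq ((𝔖.kerShadow ζ).shP q) (𝟭 X) := by
  intro b q
  induction q with
  | nil => intro n h _; exact HEq.rfl
  | cons q e ih =>
    rename_i c d
    intro n h hd
    subst hd
    cases c with
    | obs => exact (PEmpty.elim e : _)
    | base c =>
      obtain ⟨c, hc⟩ := c
      cases c with
      | first m' =>
        have IH : (𝔖.kerShadow ζ).shP q = 𝟭 X := eq_of_heq (ih m' hc rfl)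
        cases e
        rw [PseudoShadow.shP_cons, IH]
        exact HEq.rfl
      | box => cases e
      | space => cases e
      | galois => cases e
      | ref => exact absurd rfl hc.1

/-- Paths from a vertex of row 1 to `□` have shadow `𝟭_𝒳`. [cite: MochizukiAbsTopIII2015, Cor 3.7 (iii) p.88] -/
theorem kerShadow_shP_first_box (m : ℤ) : ∀ {b : logObsShape.{u}.Vertex} (q : Path (lvFirst.{u} m) b)
    (h : Cor37Vertex.box.InDaggerLe 2), b = logObsShape.{u}.base ⟨.box, h⟩ →
    HEq ((𝔖.kerShadow ζ).shP q) (𝟭 X) := by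
  intro b q
  cases q with
  | nil => intro h e; exact absurd e (base_first_ne_lvBox m _)
  | cons q e =>
    rename_i c
    intro h hd
    subst hd
    cases c with
    | obs => exact (PEmpty.elim e : _)
    | base c =>
      obtain ⟨c, hc⟩ := c
      cases c with
      | first m' =>
        have IH : (𝔖.kerShadow ζ).shP q = 𝟭 X := eq_of_heq (𝔖.kerShadow_shP_first ζ m q m' hc rfl)
        cases e
        rw [PseudoShadow.shP_cons, IH]
        exact HEq.rfl
      | box => cases e
      | space => cases e
      | galois => cases e
      | ref => exact absurd rfl hc.1

/-- **Any two paths into `□` with the same initial vertex have the same shadow** (both are `𝟭_𝒳`,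
resp. both are empty). [cite: MochizukiAbsTopIII2015, Cor 3.7 (iii) p.88] -/
theorem kerShadow_shP_lvBox_eq {a : logObsShape.{u}.Vertex} (p q : Path a lvBox.{u}) :
    (𝔖.kerShadow ζ).shP p = (𝔖.kerShadow ζ).shP q := by
  cases a with
  | obs => exact absurd rfl (ne_lvObs_of_path_lvBox p)
  | base a =>
    obtain ⟨a, ha⟩ := a
    cases a with
    | first m =>
      exact (eq_of_heq (𝔖.kerShadow_shP_first_box ζ m p _ rfl)).trans
        (eq_of_heq (𝔖.kerShadow_shP_first_box ζ m q _ rfl)).symm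
    | box =>
      have hp := path_lvBox_eq_nil p ha rfl
      have hq := path_lvBox_eq_nil q ha rfl
      simp only at hp hq
      rw [hp, hq]
    | space => exact absurd ha.2 (by decide)
    | galois => exact absurd ha.2 (by decide)
    | ref => exact absurd rfl ha.1

end ShadowPaths

end BiAnabelianSetting

end Literature.AnabelianGeometry.AbsoluteAnabelian.AbsTopIII
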